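import Summits.CriticalPhenomena.PercolationContinuityZ3.Theorems.PercNearOneGluingNoHeavyRsw3SupercriticalCubeRate
import Summits.CriticalPhenomena.PercolationContinuityZ3.Theorems.PercAnnulusCrossingThresholdUnique
import HarnessLib

/-!
# RSW3 lane (P2, gen 25): COROLLARIES OF THE EFFECTIVE SUPERCRITICAL RATE — easy boxes, and THE FINITE-SIZE THRESHOLD OF THE
# CUBE OF `ℤ³` IS WITHIN `√(C/log n)` OF `p_c` ON BOTH SIDES (`Π_p(n) = λ ∈ (0,1) ⟹ |p − p_c(ℤ³)| ≤ √(C/log n)` for all large `n`)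

builds on p205010 (kernel theorem, internal audit signed; external expert review pending) — NOT used in this file.

Cell `prim-rsw3` (LANE 3), prover seat `prim-rsw3-p2` (gen 25), memo `run/shared/lean/prim/rsw3/P2-RSWLITE.md` §32.
Support file (`--supports stmt-CriticalPhenomena-4575`); no definitions, no named facts, no sorries.  `ℤ³`;
`Π_p(n) = boxCrossProb 3 p (cubeShape n) 0`.

The two one-sided rates — the lead's subcritical `Crossing.criticalProbI_sub_le_sqrt_of_le_cube` (gen 17, V206: `λ ≤ Π_p(n)`, `p < p_c`
`⟹ p_c − p ≤ √(2C/log n)`, from DKT 2020 Thm. 2 for `p < p_c`) and gen 25's supercritical `Rsw3.sub_criticalProbI_le_sqrt_of_cube_le`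
(`Π_p(n) ≤ λ`, `p_c < p < 1` `⟹ p − p_c ≤ √(2C/log n)`, from the effective §6 assembly of DKT 2020 Thm. 2 for `p > p_c` and the
square-in-a-slab crossing bound) — assembled:

* `exists_exp_rate_boxCross_supercritical`, `exists_exp_rate_easyShape_supercritical` — every box `(A; B, K)` with `A ≤ B`, `A ≤ K`
  (the cube, Kesten's easy shapes `(n; kn, kn)`) inherits gen 25's supercritical rate `1 − P_p ≤ exp(1 − A·e^{−C/(p−p_c)²})`
  (Kesten's Comment (v)); hard boxes `(kn; n, n)`, `k ≥ 2`, are not covered.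
* **`sq_mul_log_le_of_cube_eq`** — `∃ C > 0 ∀ λ ∈ (0,1) ∀ᶠ n ∀ p ∈ [0,1]`: `Π_p(n) = λ ⟹ (p − p_c)²·log n ≤ C ∧ |p − p_c| ≤ √(C/log n)`
  (`p = 1` is excluded by `Π_1(n) = 1`, `Rsw3.pow_le_real_boxCross`).
* **`eventually_abs_cube_level_sub_le`** — for the unique solutions `u n` of `Π_{u n}(n) = λ` (`Crossing.existsUnique_cube_level`):
  `∃ C ∀ᶠ n, |u n − p_c| ≤ √(C/log n)` — the convergence `u n → p_c(ℤ³)` of `…ThresholdUnique.lean` (V207) WITH A RATE, two-sided;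
  `eventually_cube_window_subset` — the whole crossing window `{p : λ ≤ Π_p(n) ≤ λ'}` lies in `[p_c − √(C/log n), p_c + √(C/log n)]`;
  `eventually_cube_window_width_le` — hence its width is `≤ 2√(C/log n)` (CCFS from below: `≥ c(λ'−λ) n^{-3/2}`, lead gen 17).

Reading: every numerical determination of `p_c(ℤ³)` from cube-crossing level sets (`p_eff(L)`, Böttcher–Herrmann (2.14)) is now a
kernel-certified two-sided estimator with the (very weak, but effective) modulus `(log L)^{-1/2}`; conjecturally `|p_eff(L) − p_c| ≍ L^{-1/ν}`.
Nothing is claimed AT `p_c` (where `Π_{p_c}(n)` sits in `(0,1)` is the lane's open two-sided cube RSW).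

References: H. Duminil-Copin, G. Kozma, V. Tassion, Progr. Probab. 77 (2020) = arXiv:1902.03207, Thm. 2 [DuminilcopinKozmaTassion2020];
L. Böttcher, H. J. Herrmann, *Computational Statistical Physics* (2021), §2.3.6 eq. (2.14) [BottcherHerrmann2021]; G. Grimmett,
*Percolation* (1999), §2.4 Thm. (2.25), §7.4 [GrimmettPercolation1999].
-/

noncomputable section

namespace Summit.CriticalPhenomena.PercolationContinuityZ3.Theorems.Rsw3

open MeasureTheory Filter Topology Literature.Probability.LatticeModels Literature.Probability.Percolation
open Summit.CriticalPhenomena.PercolationContinuityZ3.Theorems.Crossing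

/-- At `p = 1` every cube is crossed: `Π_1(n) = 1` (`1 = 1^n ≤ Π_1(n) ≤ 1`). [folklore] -/
theorem boxCrossProb_cubeShape_eq_one_of_coe_eq_one (p : unitInterval) (hp : (p : ℝ) = 1) (n : ℕ) :
    boxCrossProb 3 p (cubeShape n) 0 = 1 := by
  have hL : ∀ j, 0 ≤ cubeShape n j := fun j => by fin_cases j <;> simp [cubeShape]
  have h := pow_le_real_boxCross p hL 0
  rw [hp, one_pow] at h
  unfold boxCrossProb
  exact le_antisymm measureReal_le_one h

/-! ## Every box no longer than it is wide inherits the rate (easy shapes, the cube) -/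

/-- **Boxes no longer than wide.**  There is `C > 0` such that for all `p ∈ (p_c(ℤ³), 1)` and all `A ≤ B`, `A ≤ K`:
`1 − P_p(boxCross (A,B,K) 0) ≤ exp(1 − A·exp(−C/(p−p_c)²))` — the box `{0..A} × {0..B} × {0..K}` is crossed in direction `0` at least as
easily as the cube `{0..A}³` (Kesten's Comment (v), `Crossing.real_boxCross_anti`).  HARD boxes (`A > B` or `A > K`) are NOT covered.
[cite: Kesten1982, §3.3 Comment (v)] [cite: DuminilcopinKozmaTassion2020, Theorem 2 (p > p_c)] -/
theorem exists_exp_rate_boxCross_supercritical :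
    ∃ C : ℝ, 0 < C ∧ ∀ p : unitInterval, (criticalProbI 3 : ℝ) < p → (p : ℝ) < 1 → ∀ A B K : ℕ, A ≤ B → A ≤ K →
      1 - boxCrossProb 3 p ![(A : ℤ), (B : ℤ), (K : ℤ)] 0 ≤
        Real.exp (1 - A * Real.exp (-(C / ((p : ℝ) - criticalProbI 3) ^ 2))) := by
  obtain ⟨C, hC, h⟩ := exists_exp_rate_cube_supercritical
  refine ⟨C, hC, fun p hpc hp1 A B K hAB hAK => ?_⟩
  have hmono : boxCrossProb 3 p (cubeShape A) 0 ≤ boxCrossProb 3 p ![(A : ℤ), (B : ℤ), (K : ℤ)] 0 := by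
    unfold boxCrossProb
    refine real_boxCross_anti p (L := ![(A : ℤ), (B : ℤ), (K : ℤ)]) (L' := cubeShape A) (i := 0) (by simp) (by simp [cubeShape])
      fun j hj => ?_
    fin_cases j
    · exact (hj rfl).elim
    · simp [cubeShape]; exact_mod_cast hAB
    · simp [cubeShape]; exact_mod_cast hAK
  have := h p hpc hp1 A
  linarith

/-- **Easy shapes.**  For every `k ≥ 1`: `1 − P_p(boxCross (easyShape k n) 0) ≤ exp(1 − n·exp(−C/(p−p_c)²))` for all `p ∈ (p_c, 1)` and
all `n` (one `C`, DKT's, for all `k`). [cite: Kesten1982, (3.65) and Thm. 5.1 (the easy shapes)] [cite: DuminilcopinKozmaTassion2020, Theorem 2] -/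
theorem exists_exp_rate_easyShape_supercritical :
    ∃ C : ℝ, 0 < C ∧ ∀ p : unitInterval, (criticalProbI 3 : ℝ) < p → (p : ℝ) < 1 → ∀ k n : ℕ, 1 ≤ k →
      1 - boxCrossProb 3 p (easyShape k n) 0 ≤
        Real.exp (1 - n * Real.exp (-(C / ((p : ℝ) - criticalProbI 3) ^ 2))) := by
  obtain ⟨C, hC, h⟩ := exists_exp_rate_boxCross_supercritical
  refine ⟨C, hC, fun p hpc hp1 k n hk => ?_⟩
  have hkn : n ≤ k * n := Nat.le_mul_of_pos_left n (by omega)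
  have := h p hpc hp1 n (k * n) (k * n) hkn hkn
  rw [easyShape]
  push_cast at this ⊢
  exact this

/-! ## The two-sided localisation of the cube threshold -/

/-- **THE TWO-SIDED LOCALISATION OF THE CUBE THRESHOLD.**  There is `C > 0` such that for every level `λ ∈ (0,1)`, for all large `n`
and every `p ∈ [0,1]`: `Π_p(n) = λ ⟹ (p − p_c)²·log n ≤ C` and `|p − p_c| ≤ √(C/log n)`.  (Below `p_c`: the lead's DKT-subcritical rate;
above `p_c`: gen 25's effective supercritical rate; `p = 1` is impossible since `Π_1(n) = 1`.)
[cite: DuminilcopinKozmaTassion2020, Theorem 2 (both sides of p_c)] [cite: BottcherHerrmann2021, §2.3.6 eq. (2.14)] -/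
theorem sq_mul_log_le_of_cube_eq :
    ∃ C : ℝ, 0 < C ∧ ∀ lam : ℝ, 0 < lam → lam < 1 → ∀ᶠ n : ℕ in atTop, ∀ p : unitInterval,
      boxCrossProb 3 p (cubeShape n) 0 = lam →
        ((p : ℝ) - criticalProbI 3) ^ 2 * Real.log n ≤ C ∧
          |(p : ℝ) - criticalProbI 3| ≤ Real.sqrt (C / Real.log n) := by
  obtain ⟨C₁, hC₁, h₁⟩ := criticalProbI_sub_le_sqrt_of_le_cube
  obtain ⟨C₂, hC₂, h₂⟩ := sub_criticalProbI_le_sqrt_of_cube_le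
  refine ⟨2 * max C₁ C₂, by positivity, fun lam hlam0 hlam1 => ?_⟩
  filter_upwards [h₁ lam hlam0, h₂ lam hlam1, eventually_ge_atTop 2] with n hn₁ hn₂ hn2 p hp
  have hn2' : (2 : ℝ) ≤ n := by exact_mod_cast hn2
  have hlogn0 : 0 < Real.log n := Real.log_pos (by linarith)
  have hmax1 : C₁ ≤ max C₁ C₂ := le_max_left _ _
  have hmax2 : C₂ ≤ max C₁ C₂ := le_max_right _ _
  have hsq : ((p : ℝ) - criticalProbI 3) ^ 2 * Real.log n ≤ 2 * max C₁ C₂ := by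
    rcases lt_trichotomy (p : ℝ) (criticalProbI 3) with hlt | heq | hgt
    · have h := (hn₁ p hlt hp.symm.le).1
      have : ((p : ℝ) - criticalProbI 3) ^ 2 = ((criticalProbI 3 : ℝ) - p) ^ 2 := by ring
      rw [this]; linarith
    · rw [heq, sub_self]
      have h0 : (0 : ℝ) ^ 2 * Real.log n = 0 := by ring
      rw [h0]; positivity
    · rcases lt_or_eq_of_le p.2.2 with hp1 | hp1
      · have h := (hn₂ p hgt hp1 hp.le).1
        linarith
      · exfalso
        have := boxCrossProb_cubeShape_eq_one_of_coe_eq_one p hp1 n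
        linarith
  refine ⟨hsq, ?_⟩
  have h1 : ((p : ℝ) - criticalProbI 3) ^ 2 ≤ 2 * max C₁ C₂ / Real.log n := by rw [le_div_iff₀ hlogn0]; exact hsq
  calc |(p : ℝ) - criticalProbI 3| = Real.sqrt (((p : ℝ) - criticalProbI 3) ^ 2) := (Real.sqrt_sq_eq_abs _).symm
    _ ≤ Real.sqrt (2 * max C₁ C₂ / Real.log n) := Real.sqrt_le_sqrt h1

/-- **THE UNIQUE CUBE THRESHOLDS CONVERGE TO `p_c(ℤ³)` AT RATE `(log n)^{-1/2}`, TWO-SIDED.**  For `λ ∈ (0,1)` and any `u : ℕ → [0,1]`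
solving `Π_{u n}(n) = λ` for all `n ≥ 1` (the unique solutions of `Crossing.existsUnique_cube_level`): there is `C > 0` (DKT's, not
depending on `λ`) with `|u n − p_c| ≤ √(C/log n)` for all large `n` — the rate form of `Crossing.tendsto_coe_criticalProbI_of_cube_level_eq`.
[cite: DuminilcopinKozmaTassion2020, Theorem 2] [cite: BottcherHerrmann2021, §2.3.6 eq. (2.14)] -/
theorem eventually_abs_cube_level_sub_le :
    ∃ C : ℝ, 0 < C ∧ ∀ lam : ℝ, 0 < lam → lam < 1 → ∀ u : ℕ → unitInterval,
      (∀ n : ℕ, 1 ≤ n → boxCrossProb 3 (u n) (cubeShape n) 0 = lam) →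
        ∀ᶠ n : ℕ in atTop, |(u n : ℝ) - criticalProbI 3| ≤ Real.sqrt (C / Real.log n) := by
  obtain ⟨C, hC, h⟩ := sq_mul_log_le_of_cube_eq
  refine ⟨C, hC, fun lam hlam0 hlam1 u hu => ?_⟩
  filter_upwards [h lam hlam0 hlam1, eventually_ge_atTop 1] with n hn hn1
  exact (hn (u n) (hu n hn1)).2

/-- **THE WHOLE CROSSING WINDOW IS LOCALISED**: for levels `0 < λ ≤ λ' < 1` there is `C > 0` (DKT's) such that for all large `n` and all
`p`: `λ ≤ Π_p(n) ≤ λ' ⟹ |p − p_c| ≤ √(C/log n)` — the level band `[λ, λ']` of the cube crossing curve at scale `n` lies in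
`[p_c − √(C/log n), p_c + √(C/log n)]` (its width is `≥ c·n^{-3/2}` by the lead's CCFS bound `lt_and_sub_le_of_cube_levels`).
[cite: DuminilcopinKozmaTassion2020, Theorem 2] -/
theorem eventually_cube_window_subset :
    ∃ C : ℝ, 0 < C ∧ ∀ lam lam' : ℝ, 0 < lam → lam' < 1 → ∀ᶠ n : ℕ in atTop, ∀ p : unitInterval,
      lam ≤ boxCrossProb 3 p (cubeShape n) 0 → boxCrossProb 3 p (cubeShape n) 0 ≤ lam' →
        |(p : ℝ) - criticalProbI 3| ≤ Real.sqrt (C / Real.log n) := by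
  obtain ⟨C₁, hC₁, h₁⟩ := criticalProbI_sub_le_sqrt_of_le_cube
  obtain ⟨C₂, hC₂, h₂⟩ := sub_criticalProbI_le_sqrt_of_cube_le
  refine ⟨2 * max C₁ C₂, by positivity, fun lam lam' hlam0 hlam1 => ?_⟩
  filter_upwards [h₁ lam hlam0, h₂ lam' hlam1, eventually_ge_atTop 2] with n hn₁ hn₂ hn2 p hlo hhi
  have hn2' : (2 : ℝ) ≤ n := by exact_mod_cast hn2
  have hlogn0 : 0 < Real.log n := Real.log_pos (by linarith)
  have hmax1 : C₁ ≤ max C₁ C₂ := le_max_left _ _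
  have hmax2 : C₂ ≤ max C₁ C₂ := le_max_right _ _
  have hsq : ((p : ℝ) - criticalProbI 3) ^ 2 * Real.log n ≤ 2 * max C₁ C₂ := by
    rcases lt_trichotomy (p : ℝ) (criticalProbI 3) with hlt | heq | hgt
    · have h := (hn₁ p hlt hlo).1
      have : ((p : ℝ) - criticalProbI 3) ^ 2 = ((criticalProbI 3 : ℝ) - p) ^ 2 := by ring
      rw [this]; linarith
    · rw [heq, sub_self]
      have h0 : (0 : ℝ) ^ 2 * Real.log n = 0 := by ring
      rw [h0]; positivity
    · rcases lt_or_eq_of_le p.2.2 with hp1 | hp1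
      · have h := (hn₂ p hgt hp1 hhi).1
        linarith
      · exfalso
        have := boxCrossProb_cubeShape_eq_one_of_coe_eq_one p hp1 n
        linarith
  have h1 : ((p : ℝ) - criticalProbI 3) ^ 2 ≤ 2 * max C₁ C₂ / Real.log n := by rw [le_div_iff₀ hlogn0]; exact hsq
  calc |(p : ℝ) - criticalProbI 3| = Real.sqrt (((p : ℝ) - criticalProbI 3) ^ 2) := (Real.sqrt_sq_eq_abs _).symm
    _ ≤ Real.sqrt (2 * max C₁ C₂ / Real.log n) := Real.sqrt_le_sqrt h1

/-- **THE CROSSING WINDOW HAS WIDTH `≤ 2√(C/log n)`**: for levels `0 < λ`, `λ' < 1` there is `C > 0` (DKT's) such that for all large `n`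
and all `p, q`: `λ ≤ Π_q(n)`, `Π_p(n) ≤ λ'` ⟹ `p − q ≤ 2√(C/log n)` — in particular the level-`λ` and level-`λ'` thresholds satisfy
`p_n(λ') − p_n(λ) ≤ 2√(C/log n)`; the lead's CCFS bound gives `≥ (λ'−λ)·c·n^{-3/2}` from below (`lt_and_sub_le_of_cube_levels`), and
Talagrand's inequality `≲ 1/|log π_{p_n}(n/2)|` (`eventually_cube_level_gap_mul_log_le`). [cite: DuminilcopinKozmaTassion2020, Theorem 2]
[cite: BottcherHerrmann2021, §2.3.6 eq. (2.14)] -/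
theorem eventually_cube_window_width_le :
    ∃ C : ℝ, 0 < C ∧ ∀ lam lam' : ℝ, 0 < lam → lam' < 1 → ∀ᶠ n : ℕ in atTop, ∀ p q : unitInterval,
      lam ≤ boxCrossProb 3 q (cubeShape n) 0 → boxCrossProb 3 p (cubeShape n) 0 ≤ lam' →
        (p : ℝ) - q ≤ 2 * Real.sqrt (C / Real.log n) := by
  obtain ⟨C₁, hC₁, h₁⟩ := criticalProbI_sub_le_sqrt_of_le_cube
  obtain ⟨C₂, hC₂, h₂⟩ := sub_criticalProbI_le_sqrt_of_cube_le
  refine ⟨2 * max C₁ C₂, by positivity, fun lam lam' hlam0 hlam1 => ?_⟩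
  filter_upwards [h₁ lam hlam0, h₂ lam' hlam1, eventually_ge_atTop 2] with n hn₁ hn₂ hn2 p q hlo hhi
  have hn2' : (2 : ℝ) ≤ n := by exact_mod_cast hn2
  have hlogn0 : 0 < Real.log n := Real.log_pos (by linarith)
  have hmax1 : C₁ ≤ max C₁ C₂ := le_max_left _ _
  have hmax2 : C₂ ≤ max C₁ C₂ := le_max_right _ _
  have hS0 : 0 ≤ Real.sqrt (2 * max C₁ C₂ / Real.log n) := Real.sqrt_nonneg _
  have hmonoS : ∀ {C : ℝ}, C ≤ max C₁ C₂ → Real.sqrt (2 * C / Real.log n) ≤ Real.sqrt (2 * max C₁ C₂ / Real.log n) :=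
    fun hC => Real.sqrt_le_sqrt (by gcongr)
  -- `q ≥ p_c − √(2C₁/log n)` (or `q ≥ p_c`)
  have hq : (criticalProbI 3 : ℝ) - q ≤ Real.sqrt (2 * max C₁ C₂ / Real.log n) := by
    rcases lt_or_ge (q : ℝ) (criticalProbI 3) with hlt | hge
    · exact ((hn₁ q hlt hlo).2).trans (hmonoS hmax1)
    · linarith
  -- `p ≤ p_c + √(2C₂/log n)` (or `p ≤ p_c`; `p = 1` impossible)
  have hp : (p : ℝ) - criticalProbI 3 ≤ Real.sqrt (2 * max C₁ C₂ / Real.log n) := by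
    rcases lt_or_ge (criticalProbI 3 : ℝ) p with hgt | hle
    · rcases lt_or_eq_of_le p.2.2 with hp1 | hp1
      · exact ((hn₂ p hgt hp1 hhi).2).trans (hmonoS hmax2)
      · exfalso
        have := boxCrossProb_cubeShape_eq_one_of_coe_eq_one p hp1 n
        linarith
    · linarith
  linarith

end Summit.CriticalPhenomena.PercolationContinuityZ3.Theorems.Rsw3

end
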